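import Summits.CriticalPhenomena.PercolationContinuityZ3.Theorems.PercNearOneGluingNoHeavyQuantIndepLegsFarSub
import Summits.CriticalPhenomena.PercolationContinuityZ3.Theorems.PercNearOneGluingNoHeavyQuantFarRelayRow
import HarnessLib

/-!
# QUANT lane R8: FAR (`Quant.FarRelayRow`) PROVED for spiders — the percolation-vocabulary bridge to
# `Quant.far_indepLegs_sub`

builds on p205010 (kernel theorem, internal audit signed; external expert review pending)

Support file (`--supports stmt-CriticalPhenomena-4575`), QUANT lane typer seat prim-quant-stmt (gen 9); memos
`run/shared/lean/prim/quant/CENSUS-GAIN.md` §14.2 (census-1 g6: FAR for independent legs, 110.9 M exact instances, kernel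
`Quant.far_indepLegs` p217240 / relay-subset form `Quant.far_indepLegs_sub` p218880) and `run/shared/lean/prim/quant/STATEMENTS.md` §K.
Theorems only; no definitions, no sorries, standard axioms.

`Quant.FarRelayRow` (`…QuantFarRelayRow.lean`, the lane's R8 target of record, OPEN in general) says: on every finite weighted graph,
`2j < Σ_{a∈A} P(o ↔ a)` and `P(o ↮ a) ≤ t` for all `a ∈ A` imply `P(#{a ∈ A | o ↔ a} ≤ j) ≤ t`.  It is proved in the route's
vocabulary for stars (`Quant.farRelayRow_star`, p216859) and block-stars (`Quant.farRelayRow_blockStar`, p217287); census-1 g6 proved the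
abstract gate-coordinate form for SPIDERS (independent legs, arbitrary relay subset: `Quant.far_indepLegs_sub` / `_root`) and left the
bridge to the graph vocabulary open.  This file is that bridge.

**Spiders in coordinates.**  A spider centred at the observer `o` on the vertex set `Fin n` is given by three maps: `leg x : J` (which leg
the vertex `x ≠ o` lies on), `depth x : ℕ` (how far out; the neighbour of `o` has depth `0`) and `par x` (the next vertex towards `o`), with
(i) `par x = o` at depth `0`, (ii) otherwise `par x ≠ o` lies on the same leg one step down, (iii) `(leg, depth)` injective off `o`.  The weights are
SPIDER-SUPPORTED if every pair of nonzero weight is a loop or a parent pair `s(par x, x)` (`x ≠ o`); the weights of the parent pairs are arbitrary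
(weight `0` truncates a leg, weight `1` glues).  The values `leg o`, `depth o`, `par o` are irrelevant.  `depth ≡ 0`, `par ≡ o`, `leg = id`
is the star of `farRelayRow_star` (which `farRelayRow_spider` then recovers verbatim — checked, not re-landed).

* `Quant.spider_gate_injective` — distinct vertices `x, y ≠ o` have distinct parent pairs.
* `Quant.openWalk_spider_invariant` — on a configuration whose open non-loop pairs are parent pairs, along an open walk the property
  '`v = o`, or every parent pair on the leg of `v` at depth `≤ depth v` is open' propagates (induction on the walk, as in
  `openWalk_blockStar_invariant`).
* `Quant.mem_openConn_of_spider_gates` — conversely, if every parent pair below `a` on its leg is open then `o ↔ a` (induction on the depth).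
* `Quant.farRelayRow_spider` — **FAR holds for spider-supported weights**: for every `A`, `j`, `t`, `2j < Σ_{a∈A} P(o ↔ a)` and
  `P(o ↮ a) ≤ t` (`a ∈ A`) imply `P(#{a ∈ A | o ↔ a} ≤ j) ≤ t` — verbatim the body of `Quant.FarRelayRow`.  PROOF: configurations containing a
  weight-`0` pair are null, so a.s. every open non-loop pair is a parent pair and `o ↔ a ⟺` all parent pairs below `a` are open; the reading
  `ω ↦ {x | x = o ∨ s(par x, x) ∈ ω}` is a product Bernoulli configuration on `Fin n` with parameters `q x = w s(par x, x)` (`q o = 1`) by the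
  block principle `prodBernoulli_real_preimage_readBlocks` (blocks = the child vertex of each parent pair); in these coordinates the marginal of
  `a ≠ o` is `∏_{leg y = leg a, depth y ≤ depth a} q y`, the event is `#{a ∈ A ∖ o | prefix of a open} (+1 if o ∈ A) ≤ j`, and the claim is
  `Quant.far_indepLegs_sub` (cell `o ∉ A`) / `Quant.far_indepLegs_sub_root` (cell `o ∈ A`).
Third unconditional infinite family for FAR beyond the Markov regime, and the first with legs of arbitrary length (relay counts per leg of
arbitrary law); branching trees remain open (CENSUS-GAIN §14.3). [cite: KozmaNitzan2024, Lemma 2 (p. 6), Conjecture 3 (p. 15)]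
-/

noncomputable section

namespace Summit.CriticalPhenomena.PercolationContinuityZ3.Theorems

namespace Quant

open Finset MeasureTheory
open Literature.Probability.LatticeModels
open Literature.Probability.Percolation
open scoped Classical

variable {n : ℕ} {J : Type*}

/-- In a spider (parent map `par`, depths `depth`, legs `leg`; root `o`), distinct vertices `x, y ≠ o` have distinct parent pairs:
`s(par x, x) = s(par y, y) → x = y`. [this work] -/
theorem spider_gate_injective (o : Fin n) (leg : Fin n → J) (depth : Fin n → ℕ) (par : Fin n → Fin n)
    (hroot : ∀ x, x ≠ o → depth x = 0 → par x = o)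
    (hstep : ∀ x, x ≠ o → depth x ≠ 0 → par x ≠ o ∧ leg (par x) = leg x ∧ depth (par x) + 1 = depth x)
    {x y : Fin n} (hx : x ≠ o) (hy : y ≠ o) (h : s(par x, x) = s(par y, y)) : x = y := by
  rcases Sym2.eq_iff.1 h with ⟨-, hxy⟩ | ⟨hpx, hxp⟩
  · exact hxy
  · -- `par x = y` and `x = par y`: impossible along a chain towards `o`
    exfalso
    have hdy : depth y ≠ 0 := fun hd => hx (hxp.trans (hroot y hy hd))
    have hdx : depth x ≠ 0 := fun hd => hy (hpx.symm.trans (hroot x hx hd))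
    obtain ⟨-, -, h1⟩ := hstep y hy hdy
    obtain ⟨-, -, h2⟩ := hstep x hx hdx
    rw [← hxp] at h1
    rw [hpx] at h2
    omega

/-- **Walk invariant of a spider configuration.**  If every open non-loop pair of the configuration `ω` is a parent pair
`s(par x, x)` (`x ≠ o`) of the spider, then along any open walk the property '`v = o`, or `v ≠ o` and every parent pair `s(par y, y)` with
`y ≠ o` on the leg of `v` at depth `≤ depth v` is open' propagates from the start to the end of the walk. [this work] -/
theorem openWalk_spider_invariant (o : Fin n) (leg : Fin n → J) (depth : Fin n → ℕ) (par : Fin n → Fin n)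
    (hroot : ∀ x, x ≠ o → depth x = 0 → par x = o)
    (hstep : ∀ x, x ≠ o → depth x ≠ 0 → par x ≠ o ∧ leg (par x) = leg x ∧ depth (par x) + 1 = depth x)
    (hinj : ∀ x y, x ≠ o → y ≠ o → leg x = leg y → depth x = depth y → x = y)
    (ω : BondConfig (Fin n))
    (hω : ∀ u v, u ≠ v → s(u, v) ∈ ω → ∃ x, x ≠ o ∧ s(u, v) = s(par x, x)) :
    ∀ (u v : Fin n) (q : (openGraph ω).Walk u v),
      (u = o ∨ (u ≠ o ∧ ∀ y, y ≠ o → leg y = leg u → depth y ≤ depth u → s(par y, y) ∈ ω)) →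
      (v = o ∨ (v ≠ o ∧ ∀ y, y ≠ o → leg y = leg v → depth y ≤ depth v → s(par y, y) ∈ ω)) := by
  intro u v q
  induction q with
  | nil => exact id
  | cons hadj q' ih =>
    rename_i u' x v'
    intro hu
    apply ih
    rw [openGraph_adj] at hadj
    obtain ⟨hmem, hux⟩ := hadj
    obtain ⟨z, hzo, hz⟩ := hω u' x hux hmem
    rcases Sym2.eq_iff.1 hz with ⟨hu'z, hxz⟩ | ⟨hu'z, hxz⟩
    · -- `u' = par z`, `x = z`: the step moves away from the root
      right
      refine ⟨hxz ▸ hzo, fun y hyo hly hdy => ?_⟩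
      rw [hxz] at hly hdy
      rcases Nat.eq_or_lt_of_le hdy with hde | hdl
      · rw [hinj y z hyo hzo hly hde, ← hz]
        exact hmem
      · have hdz : depth z ≠ 0 := by omega
        obtain ⟨hpo, hpl, hpd⟩ := hstep z hzo hdz
        rcases hu with hu | ⟨-, hu⟩
        · exact absurd (hu'z.symm.trans hu) hpo
        · have hlu : leg u' = leg z := by rw [hu'z]; exact hpl
          have hdu : depth y ≤ depth u' := by rw [hu'z]; omega
          exact hu y hyo (hly.trans hlu.symm) hdu
    · -- `u' = z`, `x = par z`: the step moves towards the root
      by_cases hpo : par z = o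
      · exact Or.inl (hxz.trans hpo)
      · right
        have hdz : depth z ≠ 0 := fun hd => hpo (hroot z hzo hd)
        obtain ⟨-, hpl, hpd⟩ := hstep z hzo hdz
        refine ⟨fun hxo => hpo (hxz ▸ hxo), fun y hyo hly hdy => ?_⟩
        rw [hxz] at hly hdy
        rcases hu with hu | ⟨-, hu⟩
        · exact absurd (hu'z.symm.trans hu) hzo
        · have hlu : leg u' = leg z := by rw [hu'z]
          have hdu : depth y ≤ depth u' := by rw [hu'z]; omega
          exact hu y hyo (hly.trans (hpl.trans hlu.symm)) hdu

/-- **Open prefix gives connection.**  In a spider, if every parent pair `s(par y, y)` with `y ≠ o` on the leg of `a ≠ o` at depth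
`≤ depth a` is open in `ω`, then `o ↔ a` in `ω` (the open walk `o, …, par (par a), par a, a`; induction on the depth). [this work] -/
theorem mem_openConn_of_spider_gates (o : Fin n) (leg : Fin n → J) (depth : Fin n → ℕ) (par : Fin n → Fin n)
    (hroot : ∀ x, x ≠ o → depth x = 0 → par x = o)
    (hstep : ∀ x, x ≠ o → depth x ≠ 0 → par x ≠ o ∧ leg (par x) = leg x ∧ depth (par x) + 1 = depth x)
    (ω : BondConfig (Fin n)) (a : Fin n) (hao : a ≠ o)
    (h : ∀ y, y ≠ o → leg y = leg a → depth y ≤ depth a → s(par y, y) ∈ ω) :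
    ω ∈ openConn o a := by
  have key : ∀ (d : ℕ) (y : Fin n), y ≠ o → leg y = leg a → depth y ≤ depth a → depth y = d →
      (openGraph ω).Reachable o y := by
    intro d
    induction d with
    | zero =>
      intro y hyo hly hdy hd0
      have hpy := hroot y hyo hd0
      have hadj : (openGraph ω).Adj o y := by
        rw [openGraph_adj]
        refine ⟨?_, fun h' => hyo h'.symm⟩
        have := h y hyo hly hdy
        rwa [hpy] at this
      exact hadj.reachable
    | succ d ih =>
      intro y hyo hly hdy hdS
      obtain ⟨hpo, hpl, hpd⟩ := hstep y hyo (by omega)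
      have hreach : (openGraph ω).Reachable o (par y) :=
        ih (par y) hpo (hpl.trans hly) (by omega) (by omega)
      have hadj : (openGraph ω).Adj (par y) y := by
        rw [openGraph_adj]
        refine ⟨h y hyo hly hdy, fun h' => ?_⟩
        rw [h'] at hpd
        omega
      exact hreach.trans hadj.reachable
  exact key (depth a) a hao rfl le_rfl rfl

/-- **FAR (`Quant.FarRelayRow`) holds for spider-supported weights.**  Data: a spider centred at `o` on `Fin n` in coordinates
(`leg`, `depth`, `par` with `par x = o` at depth `0`, otherwise `par x ≠ o` one step down the same leg, and `(leg, depth)` injective off `o`)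
and a weight function all of whose nonzero weights sit on loops or parent pairs `s(par x, x)`, `x ≠ o` (these weights arbitrary).  Then for
every vertex set `A`, layer `j` and `t`: `2j < Σ_{a∈A} P(o ↔ a)` and `P(o ↮ a) ≤ t` for all `a ∈ A` imply `P(#{a ∈ A | o ↔ a} ≤ j) ≤ t` —
verbatim the body of `Quant.FarRelayRow`.  Proof: a.s. `o ↔ a` iff the parent pairs below `a` are all open
(`openWalk_spider_invariant`, `mem_openConn_of_spider_gates`); the set of vertices whose parent pair is open is product Bernoulli
(`prodBernoulli_real_preimage_readBlocks`); conclude with census-1's `Quant.far_indepLegs_sub` / `Quant.far_indepLegs_sub_root`.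
builds on p205010 (kernel theorem, internal audit signed; external expert review pending). [this work] -/
theorem farRelayRow_spider [Fintype J] (n : ℕ) (w : Sym2 (Fin n) → unitInterval) (A : Finset (Fin n)) (o : Fin n)
    (j : ℕ) (t : ℝ) (leg : Fin n → J) (depth : Fin n → ℕ) (par : Fin n → Fin n)
    (hroot : ∀ x, x ≠ o → depth x = 0 → par x = o)
    (hstep : ∀ x, x ≠ o → depth x ≠ 0 → par x ≠ o ∧ leg (par x) = leg x ∧ depth (par x) + 1 = depth x)
    (hinj : ∀ x y, x ≠ o → y ≠ o → leg x = leg y → depth x = depth y → x = y)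
    (hsupp : ∀ e, w e ≠ 0 → e.IsDiag ∨ ∃ x, x ≠ o ∧ e = s(par x, x))
    (hEN : (2 * j : ℝ) < ∑ a ∈ A, (prodBernoulli w).real (openConn o a))
    (ht : ∀ a ∈ A, (prodBernoulli w).real (openConn o a)ᶜ ≤ t) :
    (prodBernoulli w).real {ω : BondConfig (Fin n) | (A.filter fun a => ω ∈ openConn o a).card ≤ j} ≤ t := by
  set μ := prodBernoulli w with hμ
  have hmeasB : ∀ S : Set (BondConfig (Fin n)), MeasurableSet S := fun S => (Set.toFinite S).measurableSet
  -- parent pairs ("gates") are distinct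
  have hginj : ∀ x y, x ≠ o → y ≠ o → s(par x, x) = s(par y, y) → x = y := fun x y hx hy h =>
    spider_gate_injective o leg depth par hroot hstep hx hy h
  -- good configurations (every open pair has nonzero weight) have full measure
  set G : Set (BondConfig (Fin n)) := {ω | ∀ e ∈ ω, w e ≠ 0} with hG
  have hGnull : μ.real Gᶜ = 0 := by
    set Z : Finset (Sym2 (Fin n)) := univ.filter (fun e => w e = 0) with hZ
    have hsub : Gᶜ ⊆ {ω : Set (Sym2 (Fin n)) | ∃ e ∈ Z, e ∈ ω} := by
      intro ω hω
      have hω' : ¬ ∀ e ∈ ω, w e ≠ 0 := hω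
      push Not at hω'
      obtain ⟨e, he, hwe⟩ := hω'
      exact ⟨e, Finset.mem_filter.2 ⟨Finset.mem_univ _, hwe⟩, he⟩
    have h1 : μ.real {ω : Set (Sym2 (Fin n)) | ∃ e ∈ Z, e ∈ ω} ≤ ∑ e ∈ Z, (w e : ℝ) :=
      prodBernoulli_real_exists_mem_le_sum w Z
    have h2 : ∑ e ∈ Z, (w e : ℝ) = 0 := Finset.sum_eq_zero fun e he => by
      rw [Finset.mem_filter] at he
      simp [he.2]
    exact le_antisymm ((measureReal_mono hsub (measure_ne_top _ _)).trans (h1.trans h2.le)) measureReal_nonneg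
  have hcongr : ∀ X Y : Set (BondConfig (Fin n)), (∀ ω ∈ G, ω ∈ X ↔ ω ∈ Y) → μ.real X = μ.real Y := by
    have key : ∀ X Y : Set (BondConfig (Fin n)), (∀ ω ∈ G, ω ∈ X → ω ∈ Y) → μ.real X ≤ μ.real Y := by
      intro X Y h
      have hsub : X ⊆ Y ∪ Gᶜ := fun ω hω => by
        by_cases hωG : ω ∈ G
        · exact Or.inl (h ω hωG hω)
        · exact Or.inr hωG
      calc μ.real X ≤ μ.real (Y ∪ Gᶜ) := measureReal_mono hsub (measure_ne_top _ _)
        _ ≤ μ.real Y + μ.real Gᶜ := measureReal_union_le _ _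
        _ = μ.real Y := by rw [hGnull, add_zero]
    intro X Y h
    exact le_antisymm (key X Y fun ω hω => (h ω hω).1) (key Y X fun ω hω => (h ω hω).2)
  -- on a good configuration every open non-loop pair is a parent pair
  have hgood : ∀ ω ∈ G, ∀ u v, u ≠ v → s(u, v) ∈ ω → ∃ x, x ≠ o ∧ s(u, v) = s(par x, x) := by
    intro ω hω u v huv he
    rcases hsupp _ (hω _ he) with hd | h
    · exact absurd (Sym2.mk_isDiag_iff.1 hd) huv
    · exact h
  -- prefixes and the gate reading (the root counts as an always-open gate)
  set P : Fin n → Finset (Fin n) := fun x => univ.filter (fun y => leg y = leg x ∧ depth y ≤ depth x) with hP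
  set g : Fin n → Set (Sym2 (Fin n)) → Prop := fun x ω => x = o ∨ (x ≠ o ∧ s(par x, x) ∈ ω) with hg
  set R : BondConfig (Fin n) → Set (Fin n) := fun ω => {x | g x ω} with hR
  have hPR : ∀ (ω : BondConfig (Fin n)) (a : Fin n), (((P a : Finset (Fin n)) : Set (Fin n)) ⊆ R ω) ↔
      ∀ y, y ≠ o → leg y = leg a → depth y ≤ depth a → s(par y, y) ∈ ω := by
    intro ω a
    constructor
    · intro h y hyo hly hdy
      have hyP : y ∈ ((P a : Finset (Fin n)) : Set (Fin n)) := by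
        rw [Finset.mem_coe]
        simp only [hP, Finset.mem_filter, Finset.mem_univ, true_and]
        exact ⟨hly, hdy⟩
      rcases h hyP with hy | ⟨-, hy⟩
      · exact absurd hy hyo
      · exact hy
    · intro h y hy
      rw [Finset.mem_coe] at hy
      simp only [hP, Finset.mem_filter, Finset.mem_univ, true_and] at hy
      by_cases hyo : y = o
      · exact Or.inl hyo
      · exact Or.inr ⟨hyo, h y hyo hy.1 hy.2⟩
  -- a.s.: `o ↔ a` iff the prefix of `a` is open
  have hconn : ∀ ω ∈ G, ∀ a, a ≠ o →
      (ω ∈ openConn o a ↔ ((P a : Finset (Fin n)) : Set (Fin n)) ⊆ R ω) := by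
    intro ω hω a hao
    rw [hPR]
    constructor
    · intro h
      have hr : (openGraph ω).Reachable o a := h
      obtain ⟨p⟩ := hr
      rcases openWalk_spider_invariant o leg depth par hroot hstep hinj ω (hgood ω hω) o a p (Or.inl rfl) with
        h' | ⟨-, h'⟩
      · exact absurd h' hao
      · exact h'
    · exact mem_openConn_of_spider_gates o leg depth par hroot hstep ω a hao
  -- the reading is product Bernoulli with parameters `q`
  set q : Fin n → unitInterval := fun x => if x = o then 1 else w s(par x, x) with hq
  set blk : Sym2 (Fin n) → Fin n := fun e => if h : ∃ x, x ≠ o ∧ s(par x, x) = e then Classical.choose h else o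
    with hblk
  have hblk' : ∀ x, x ≠ o → blk s(par x, x) = x := by
    intro x hxo
    have hex : ∃ x', x' ≠ o ∧ s(par x', x') = s(par x, x) := ⟨x, hxo, rfl⟩
    have : blk s(par x, x) = Classical.choose hex := by simp only [hblk]; rw [dif_pos hex]
    rw [this]
    exact hginj _ _ (Classical.choose_spec hex).1 hxo (Classical.choose_spec hex).2
  have hloc : IsBlockLocal blk g := by
    intro x ω ω' hagree
    by_cases hxo : x = o
    · simp only [hg, hxo, true_or]
    · exact or_congr Iff.rfl (and_congr Iff.rfl (hagree _ (hblk' x hxo)))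
  have hmeasg : ∀ x, Measurable (g x) := fun x => Measurable.of_discrete
  have hq' : ∀ x, μ.real {ω | g x ω} = q x := by
    intro x
    by_cases hxo : x = o
    · have : {ω : Set (Sym2 (Fin n)) | g x ω} = Set.univ := Set.eq_univ_of_forall fun ω => Or.inl hxo
      rw [this, probReal_univ]
      simp [hq, hxo]
    · have : {ω : Set (Sym2 (Fin n)) | g x ω} = {ω | s(par x, x) ∈ ω} := by
        ext ω
        simp only [hg, Set.mem_setOf_eq, hxo, false_or, ne_eq, not_false_eq_true, true_and]
      rw [this, hμ, prodBernoulli_real_setOf_mem]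
      simp [hq, hxo]
  have hread : ∀ S : Set (Set (Fin n)), μ.real (R ⁻¹' S) = (prodBernoulli q).real S := fun S =>
    prodBernoulli_real_preimage_readBlocks w blk hloc hmeasg q hq' MeasurableSet.of_discrete
  -- marginals in the new coordinates
  have hmarg : ∀ a, a ≠ o → μ.real (openConn o a) = ∏ y ∈ P a, (q y : ℝ) := by
    intro a hao
    calc μ.real (openConn o a) = μ.real (R ⁻¹' {ω' | ((P a : Finset (Fin n)) : Set (Fin n)) ⊆ ω'}) :=
          hcongr _ _ fun ω hω => hconn ω hω a hao
      _ = (prodBernoulli q).real {ω' | ((P a : Finset (Fin n)) : Set (Fin n)) ⊆ ω'} := hread _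
      _ = ∏ y ∈ P a, (q y : ℝ) := prodBernoulli_real_subset q (P a)
  have hself : μ.real (openConn o o) = 1 := by
    have : (openConn o o : Set (BondConfig (Fin n))) = Set.univ :=
      Set.eq_univ_of_forall fun ω => SimpleGraph.Reachable.refl o
    rw [this, probReal_univ]
  have ht' : ∀ x ∈ A.erase o, 1 - ∏ y ∈ P x, (q y : ℝ) ≤ t := by
    intro x hx
    have hxo : x ≠ o := (Finset.mem_erase.1 hx).1
    have := ht x (Finset.mem_erase.1 hx).2
    rwa [probReal_compl_eq_one_sub (hmeasB _), hmarg x hxo] at this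
  -- the two cells
  by_cases hoA : o ∈ A
  · -- cell `o ∈ A`: the observer counts itself
    rcases Nat.eq_zero_or_eq_succ_pred j with hj0 | hjS
    · -- layer 0: the event is empty since `o ↔ o`
      have hempty : {ω : BondConfig (Fin n) | (A.filter fun a => ω ∈ openConn o a).card ≤ j} = ∅ := by
        rw [Set.eq_empty_iff_forall_notMem]
        intro ω hω
        have hle : (A.filter fun a => ω ∈ openConn o a).card ≤ j := hω
        have hpos : 0 < (A.filter fun a => ω ∈ openConn o a).card :=
          Finset.card_pos.2 ⟨o, Finset.mem_filter.2 ⟨hoA, SimpleGraph.Reachable.refl o⟩⟩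
        omega
      have ht0 : 0 ≤ t := le_trans measureReal_nonneg (ht o hoA)
      rw [hempty, measureReal_empty]
      exact ht0
    · set j' := j.pred with hj'
      set L : Set (Set (Fin n)) := {ω' | ((A.erase o).filter fun x =>
          ((univ.filter (fun y => leg y = leg x ∧ depth y ≤ depth x) : Finset (Fin n)) : Set (Fin n)) ⊆ ω').card + 1 ≤
            j' + 1} with hL
      have hSL : μ.real {ω : BondConfig (Fin n) | (A.filter fun a => ω ∈ openConn o a).card ≤ j} = μ.real (R ⁻¹' L) := by
        refine hcongr _ _ fun ω hω => ?_
        have hfilt : (A.filter fun a => ω ∈ openConn o a) =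
            insert o ((A.erase o).filter fun x => ((P x : Finset (Fin n)) : Set (Fin n)) ⊆ R ω) := by
          ext a
          simp only [Finset.mem_filter, Finset.mem_insert, Finset.mem_erase]
          constructor
          · rintro ⟨haA, hconn'⟩
            by_cases hao : a = o
            · exact Or.inl hao
            · exact Or.inr ⟨⟨hao, haA⟩, (hconn ω hω a hao).1 hconn'⟩
          · rintro (hao | ⟨⟨hao, haA⟩, hsub⟩)
            · rw [hao]
              exact ⟨hoA, SimpleGraph.Reachable.refl o⟩
            · exact ⟨haA, (hconn ω hω a hao).2 hsub⟩
        have hnot : o ∉ ((A.erase o).filter fun x => ((P x : Finset (Fin n)) : Set (Fin n)) ⊆ R ω) := fun h =>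
          (Finset.mem_erase.1 (Finset.mem_filter.1 h).1).1 rfl
        simp only [Set.mem_setOf_eq, Set.mem_preimage, hL]
        rw [hfilt, Finset.card_insert_of_notMem hnot, hjS]
      have hmean' : (2 * (j' + 1) : ℝ) < 1 + ∑ x ∈ A.erase o, ∏ y ∈ P x, (q y : ℝ) := by
        have h1 : ∑ a ∈ A, μ.real (openConn o a) = 1 + ∑ x ∈ A.erase o, ∏ y ∈ P x, (q y : ℝ) := by
          rw [← Finset.add_sum_erase A _ hoA, hself]
          congr 1
          exact Finset.sum_congr rfl fun x hx => hmarg x (Finset.mem_erase.1 hx).1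
        have h2 : (2 * j : ℝ) = 2 * (j' + 1) := by
          rw [hjS]; push_cast; ring
        linarith [hEN]
      rw [hSL, hread L]
      exact far_indepLegs_sub_root leg depth q (A.erase o) j' t hmean' ht'
  · -- cell `o ∉ A`
    set L : Set (Set (Fin n)) := {ω' | (A.filter fun x =>
        ((univ.filter (fun y => leg y = leg x ∧ depth y ≤ depth x) : Finset (Fin n)) : Set (Fin n)) ⊆ ω').card ≤ j}
      with hL
    have hAe : A.erase o = A := Finset.erase_eq_of_notMem hoA
    have hSL : μ.real {ω : BondConfig (Fin n) | (A.filter fun a => ω ∈ openConn o a).card ≤ j} = μ.real (R ⁻¹' L) := by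
      refine hcongr _ _ fun ω hω => ?_
      have hfilt : (A.filter fun a => ω ∈ openConn o a) =
          (A.filter fun x => ((P x : Finset (Fin n)) : Set (Fin n)) ⊆ R ω) :=
        Finset.filter_congr fun a haA => hconn ω hω a (fun hao => hoA (hao ▸ haA))
      simp only [Set.mem_setOf_eq, Set.mem_preimage, hL]
      rw [hfilt]
    have hmean' : (2 * j : ℝ) < ∑ x ∈ A, ∏ y ∈ P x, (q y : ℝ) := by
      have h1 : ∑ a ∈ A, μ.real (openConn o a) = ∑ x ∈ A, ∏ y ∈ P x, (q y : ℝ) :=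
        Finset.sum_congr rfl fun x hx => hmarg x (fun hxo => hoA (hxo ▸ hx))
      linarith [hEN]
    rw [hSL, hread L]
    rw [hAe] at ht'
    exact far_indepLegs_sub leg depth q A j t hmean' ht'

end Quant

end Summit.CriticalPhenomena.PercolationContinuityZ3.Theorems

end
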